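import Literature.Geometry.Manifold.DefinableEmbedding
import Literature.ModelTheory.ExponentialFields.RestrictedAnalyticDefinable
import HarnessLib

/-!
# The definable embedding of a compact real-analytic manifold — for any expansion of the real field
# defining the restricted analytic functions

Proof file (theorems only). `DefinableEmbedding.lean` builds, for a compact Hausdorff boundaryless
real-analytic manifold `M`, the continuous injective map `F = (bⱼ, bⱼ · ψⱼ)ⱼ : M → ℝᴺ` from finitely
many extended charts `ψⱼ` and semialgebraic bumps `bⱼ`, and proves that `F(e(T))` is
`ℝ_an,exp`-definable for every real-analytic `e : ℝᵐ → M` and every bounded `ℝ_an,exp`-definable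
`T ⊆ ℝᵐ`. The language-specific part of that argument is pure first-order bookkeeping over the real
field plus ONE analytic input — graphs of analytic functions over closed cubes are definable — which
holds in every first-order language `L` on `ℝ` that expands the real field
(`IsRealFieldExpansion L`) and defines the restricted analytic functions
(`∀ n (f : RestrictedAnalytic n), (univ : Set ℝ).DefinableFun L f.restrict`), by
`RestrictedAnalyticDefinable.lean`. This file re-runs the five language-specific declarations of
`DefinableEmbedding.lean` VERBATIM at that generality (the topological ones — `exists_chart_cover`,
`bump_props`, `chart_bump_data`, the profile `Θ` — are imported unchanged), so that the conclusion is
available for `ℝ_an` (o-minimal by Gabrielov 1968 / Denef–van den Dries 1988) as well as for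
`ℝ_an,exp`.

## Main statements (all proved)

* `definable_graph_profile_of_isRealFieldExpansion`, `definableFun_sum_sq_of_isRealFieldExpansion`,
  `definable_bumpChartRelation_of_isRealFieldExpansion` — the semialgebraic bookkeeping, any
  expansion of the real field.
* `exists_embedding_definable_image_of_restrictedAnalytic` — `N`, `F : M → ℝᴺ` continuous injective
  with `F(e(T))` `L`-definable for every analytic `e : ℝᵐ → M` and bounded `L`-definable `T`.
* `exists_definable_homeomorph_of_eq_image_of_restrictedAnalytic` — a closed `C = ex(T) ⊆ M`,
  `ex : E' → M` analytic, `T` bounded subanalytic, is homeomorphic to a compact `L`-definable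
  `X ⊆ ℝᴺ`.

Consumer: Buchner 1977 from the o-minimality of any such `L`
(`Riemannian/CutLocusBuchnerOMinimalExpansion.lean`).

## References

* [Dries1998] L. van den Dries, *Tame topology and o-minimal structures* (1998), Ch. 1 (2.3).
* [Pila2022] J. Pila, *Point-counting and the Zilber–Pink conjecture* (2022), 8.21 (`ℝ_an`).
-/

noncomputable section

open Set Function Filter FirstOrder
open _root_.Topology _root_.Manifold
open scoped ContDiff

namespace Literature.Geometry.Manifold

open Literature.ModelTheory.ExponentialFields

universe u v

/-! ### Semialgebraic bookkeeping in an expansion of the real field -/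

section Bookkeeping

variable {L : FirstOrder.Language.{u, v}} [L.Structure ℝ]

/-- The graph of `Θ` is definable in every expansion of the real field (it is semialgebraic: three
linear pieces). [cite: Dries1998, Ch. 1 (2.3)] -/
theorem definable_graph_profile_of_isRealFieldExpansion (hL : IsRealFieldExpansion L) :
    (univ : Set ℝ).Definable L
      {p : Fin 2 → ℝ | p 1 = max 0 (min 1 (4 * (1 - p 0) / 3))} := by
  have key : {p : Fin 2 → ℝ | p 1 = max 0 (min 1 (4 * (1 - p 0) / 3))} =
      {p : Fin 2 → ℝ | (p 0 ≤ 1 / 4 ∧ p 1 = 1) ∨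
        ((1 / 4 < p 0 ∧ p 0 < 1) ∧ 3 * p 1 = 4 * (1 - p 0)) ∨ (1 ≤ p 0 ∧ p 1 = 0)} := by
    ext p
    simp only [mem_setOf_eq]
    constructor
    · intro h
      rcases le_or_gt (p 0) (1 / 4) with h1 | h1
      · exact Or.inl ⟨h1, by rw [h, profile_eq_one h1]⟩
      rcases lt_or_ge (p 0) 1 with h2 | h2
      · refine Or.inr (Or.inl ⟨⟨h1, h2⟩, ?_⟩)
        have hlo : 0 ≤ 4 * (1 - p 0) / 3 := by linarith
        have hhi : 4 * (1 - p 0) / 3 ≤ 1 := by linarith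
        rw [min_eq_right hhi, max_eq_right hlo] at h
        rw [h]
        ring
      · exact Or.inr (Or.inr ⟨h2, by rw [h, profile_eq_zero h2]⟩)
    · rintro (⟨h1, h⟩ | ⟨⟨h1, h2⟩, h⟩ | ⟨h1, h⟩)
      · rw [h, profile_eq_one h1]
      · have hlo : 0 ≤ 4 * (1 - p 0) / 3 := by linarith
        have hhi : 4 * (1 - p 0) / 3 ≤ 1 := by linarith
        rw [min_eq_right hhi, max_eq_right hlo]
        linarith
      · rw [h, profile_eq_zero h1]
  rw [key]
  refine definable_setOf_or (definable_setOf_and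
    (hL.definable_setOf_le (definableFun_proj _) (IsRealFieldExpansion.definableFun_const _))
    (definable_setOf_eq' (definableFun_proj _) (IsRealFieldExpansion.definableFun_const _))) (definable_setOf_or
    (definable_setOf_and (definable_setOf_and
      (hL.definable_setOf_lt (IsRealFieldExpansion.definableFun_const _) (definableFun_proj _))
      (hL.definable_setOf_lt (definableFun_proj _) (IsRealFieldExpansion.definableFun_const _)))
      (definable_setOf_eq' (hL.definableFun_mul (IsRealFieldExpansion.definableFun_const _) (definableFun_proj _))
        (hL.definableFun_mul (IsRealFieldExpansion.definableFun_const _)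
          (hL.definableFun_sub (IsRealFieldExpansion.definableFun_const _) (definableFun_proj _)))))
    (definable_setOf_and (hL.definable_setOf_le (IsRealFieldExpansion.definableFun_const _) (definableFun_proj _))
      (definable_setOf_eq' (definableFun_proj _) (IsRealFieldExpansion.definableFun_const _))))

/-- `q` is a definable function of (a sub-tuple of) the variables, in every expansion of the real
field. [cite: Dries1998, Ch. 1 (2.3)] -/
theorem definableFun_sum_sq_of_isRealFieldExpansion (hL : IsRealFieldExpansion L) {n : ℕ} {γ : Type*}
    (τ : Fin n → γ) (c : Fin n → ℝ) :
    (univ : Set ℝ).DefinableFun L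
      (fun v : γ → ℝ => ∑ j, (v (τ j) - c j) ^ 2) := by
  refine hL.definableFun_sum _ fun j _ => ?_
  have h := hL.definableFun_mul (hL.definableFun_sub (definableFun_proj (τ j)) (IsRealFieldExpansion.definableFun_const (c j)))
    (hL.definableFun_sub (definableFun_proj (τ j)) (IsRealFieldExpansion.definableFun_const (c j))) (α := γ)
  simpa [sq] using h

/-- **Definability of the chart description of `F ∘ e`** (any expansion of the real field). Pure first-order bookkeeping: given a
definable `T ⊆ ℝᵐ`, finitely many definable pieces `D x ⊆ ℝᵐ` with definable graphs over `D x` of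
maps `f x : ℝᵐ → ℝⁿ`, centres `c x` and constants `r x`, the set of tuples `(z, u)`,
`z : κ × Option (Fin n) → ℝ`, `u ∈ T`, such that for every `x` EITHER `u ∈ D x` and, with
`w = f x u`, `z (x, none) = Θ((∑ (wᵢ - c x i)²) · r x)` and `z (x, some i) = z (x, none) · wᵢ`, OR
`u ∉ D x` and all `z (x, ·) = 0`, is definable. [cite: Dries1998, Ch. 1 (2.3)] -/
theorem definable_bumpChartRelation_of_isRealFieldExpansion (hL : IsRealFieldExpansion L) {κ : Type*}
    [Fintype κ] {m n : ℕ}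
    {T : Set (Fin m → ℝ)} (hT : (univ : Set ℝ).Definable L T)
    {D : κ → Set (Fin m → ℝ)} (hD : ∀ x, (univ : Set ℝ).Definable L (D x))
    (f : κ → (Fin m → ℝ) → (Fin n → ℝ))
    (hVG : ∀ x, (univ : Set ℝ).Definable L
      {w : Fin m ⊕ Fin n → ℝ | (fun j => w (Sum.inl j)) ∈ D x ∧
        ∀ i, w (Sum.inr i) = f x (fun j => w (Sum.inl j)) i})
    (c : κ → Fin n → ℝ) (r : κ → ℝ) :
    (univ : Set ℝ).Definable L
      {v : (κ × Option (Fin n)) ⊕ Fin m → ℝ | (fun j => v (Sum.inr j)) ∈ T ∧ ∀ x : κ,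
        ((fun j => v (Sum.inr j)) ∈ D x ∧ ∃ w : Fin n → ℝ,
            ((fun j => v (Sum.inr j)) ∈ D x ∧ ∀ i, w i = f x (fun j => v (Sum.inr j)) i) ∧
            v (Sum.inl (x, none)) =
              max 0 (min 1 (4 * (1 - (∑ i, (w i - c x i) ^ 2) * r x) / 3)) ∧
            ∀ i, v (Sum.inl (x, some i)) = v (Sum.inl (x, none)) * w i) ∨
        (¬ (fun j => v (Sum.inr j)) ∈ D x ∧ v (Sum.inl (x, none)) = 0 ∧
          ∀ i, v (Sum.inl (x, some i)) = 0)} := by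
  refine definable_setOf_and (definable_setOf_comp_mem hT Sum.inr) ?_
  refine definable_setOf_forall_index fun x => definable_setOf_or ?_ ?_
  · refine definable_setOf_and (definable_setOf_comp_mem (hD x) Sum.inr) ?_
    refine definable_setOf_exists_fin
      (P := fun (v : (κ × Option (Fin n)) ⊕ Fin m → ℝ) (w : Fin n → ℝ) =>
        ((fun j => v (Sum.inr j)) ∈ D x ∧ ∀ i, w i = f x (fun j => v (Sum.inr j)) i) ∧
          v (Sum.inl (x, none)) =
            max 0 (min 1 (4 * (1 - (∑ i, (w i - c x i) ^ 2) * r x) / 3)) ∧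
          ∀ i, v (Sum.inl (x, some i)) = v (Sum.inl (x, none)) * w i) ?_
    refine definable_setOf_and ?_ (definable_setOf_and ?_ ?_)
    · -- the graph of `f x` over `D x`, re-indexed
      have h := definable_setOf_comp_mem (hVG x)
        (Sum.elim (fun j => Sum.inl (Sum.inr j)) Sum.inr :
          Fin m ⊕ Fin n → ((κ × Option (Fin n)) ⊕ Fin m) ⊕ Fin n)
      exact h
    · -- `z (x, none) = Θ(q(w) r)`
      exact definable_setOf_rel (r := fun s t => t = max 0 (min 1 (4 * (1 - s) / 3)))
        (definable_graph_profile_of_isRealFieldExpansion hL)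
        (hL.definableFun_mul (definableFun_sum_sq_of_isRealFieldExpansion hL (fun i => Sum.inr i)
          (c x)) (IsRealFieldExpansion.definableFun_const _))
        (definableFun_proj _)
    · exact definable_setOf_forall_index fun i =>
        definable_setOf_eq' (definableFun_proj _)
          (hL.definableFun_mul (definableFun_proj _) (definableFun_proj _))
  · exact definable_setOf_and (definable_setOf_not (definable_setOf_comp_mem (hD x) Sum.inr))
      (definable_setOf_and (definable_setOf_eq' (definableFun_proj _) (IsRealFieldExpansion.definableFun_const _))
        (definable_setOf_forall_index fun i =>
          definable_setOf_eq' (definableFun_proj _) (IsRealFieldExpansion.definableFun_const _)))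

end Bookkeeping

/-! ### The embedding -/

section Embedding

variable {L : FirstOrder.Language.{u, v}} [L.Structure ℝ]
  {E : Type*} [NormedAddCommGroup E] [NormedSpace ℝ E]
  {H : Type*} [TopologicalSpace H] (I : ModelWithCorners ℝ E H) [I.Boundaryless]
  {M : Type*} [TopologicalSpace M] [ChartedSpace H M] [CompactSpace M] [T2Space M]

/-- **The embedding theorem, for any expansion `L` of the real field defining the restricted
analytic functions.** For a compact Hausdorff boundaryless real-analytic manifold `M` there are `N`
and a continuous injective `F : M → ℝᴺ` (hence a topological embedding) such that for every
real-analytic `e : ℝᵐ → M` and every bounded `L`-definable `T ⊆ ℝᵐ` the image `F(e(T))` is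
`L`-definable. (`F = (bⱼ, bⱼ ψⱼ)ⱼ` from finitely many charts `ψⱼ` and semialgebraic bumps `bⱼ`, exactly
the map of `exists_embedding_definable_image`; `ψⱼ ∘ e` is analytic where defined, so its graph over
finitely many closed cubes covering the relevant compact set is definable
(`IsRealFieldExpansion.exists_boxes_definable_graphOn`), and `F ∘ e` has a first-order description
there.) [cite: Pila2022, 8.21] -/
theorem exists_embedding_definable_image_of_restrictedAnalytic (hL : IsRealFieldExpansion L)
    (hAn : ∀ (n : ℕ) (f : RestrictedAnalytic n), (univ : Set ℝ).DefinableFun L f.restrict)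
    [FiniteDimensional ℝ E] [IsManifold I ω M] :
    ∃ (N : ℕ) (F : M → (Fin N → ℝ)), Continuous F ∧ Injective F ∧
      ∀ (m : ℕ) (e : (Fin m → ℝ) → M), ContMDiff 𝓘(ℝ, Fin m → ℝ) I ω e →
        ∀ T : Set (Fin m → ℝ), (univ : Set ℝ).Definable L T →
          Bornology.IsBounded T →
            (univ : Set ℝ).Definable L ((F ∘ e) '' T) := by
  classical
  -- coordinates on `E`
  set n : ℕ := Module.finrank ℝ E with hn
  have hdim : Module.finrank ℝ E = Module.finrank ℝ (Fin n → ℝ) := by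
    rw [Module.finrank_fin_fun]
  set Lc : E ≃L[ℝ] (Fin n → ℝ) := ContinuousLinearEquiv.ofFinrankEq hdim with hLcdef
  obtain ⟨t, ρ, hρ0, hρsub, hcov⟩ := exists_chart_cover (M := M) I n Lc
  -- the bumps
  set b : M → M → ℝ := fun x y => (extChartAt I x).source.indicator (fun y =>
      max 0 (min 1 (4 * (1 - (∑ j, (Lc (extChartAt I x y) j - Lc (extChartAt I x x) j) ^ 2) *
        (ρ x ^ 2)⁻¹) / 3))) y with hbdef
  have hbp := fun x : M => bump_props I Lc x (hρ0 x) (hρsub x) (b := b x) (fun y => rfl)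
  -- the map
  set F₀ : M → (↥t × Option (Fin n) → ℝ) := fun y k =>
    Option.elim k.2 (b k.1 y) (fun i => b k.1 y * Lc (extChartAt I (k.1 : M) y) i) with hF₀
  set N : ℕ := Fintype.card (↥t × Option (Fin n)) with hN
  set eqv : (↥t × Option (Fin n)) ≃ Fin N := Fintype.equivFin _ with heqv
  set F : M → (Fin N → ℝ) := fun y l => F₀ y (eqv.symm l) with hF
  have hF₀c : ∀ k, Continuous fun y => F₀ y k := by
    rintro ⟨x, _ | i⟩
    · simpa [hF₀] using (hbp x).1
    · simpa [hF₀] using (hbp x).2.1 i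
  have hFc : Continuous F := continuous_pi fun l => hF₀c (eqv.symm l)
  have hF₀inj : ∀ y y', F₀ y = F₀ y' → y = y' := by
    intro y y' h
    obtain ⟨x, hxt, hys, hq⟩ := hcov y
    have hb1 : b x y = 1 := (hbp x).2.2.2.1 y hys hq
    have hnone := congr_fun h (⟨x, hxt⟩, none)
    simp only [hF₀, Option.elim] at hnone
    have hb1' : b x y' = 1 := by rw [← hnone, hb1]
    have hys' : y' ∈ (extChartAt I x).source := (hbp x).2.2.1 y' hb1'
    have hψ : Lc (extChartAt I x y) = Lc (extChartAt I x y') := by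
      funext i
      have hi := congr_fun h (⟨x, hxt⟩, some i)
      simp only [hF₀, Option.elim] at hi
      rwa [hb1, hb1', one_mul, one_mul] at hi
    exact (extChartAt I x).injOn hys hys' (Lc.injective hψ)
  have hFinj : Injective F := by
    intro y y' h
    refine hF₀inj y y' (funext fun k => ?_)
    have := congr_fun h (eqv k)
    simpa [hF] using this
  refine ⟨N, F, hFc, hFinj, fun m e he T hT hTb => ?_⟩
  -- analyticity of `e` read in the charts
  have han : ∀ (x : M) (i : Fin n), AnalyticOnNhd ℝ (fun u => Lc (extChartAt I x (e u)) i)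
      (e ⁻¹' (extChartAt I x).source) := by
    intro x i u hu
    have hUo : IsOpen (e ⁻¹' (extChartAt I x).source) :=
      (isOpen_extChartAt_source x).preimage he.continuous
    have h1 : ContMDiffOn 𝓘(ℝ, Fin m → ℝ) 𝓘(ℝ, E) ω (fun u => extChartAt I x (e u))
        (e ⁻¹' (extChartAt I x).source) :=
      (contMDiffOn_extChartAt (x := x)).comp he.contMDiffOn fun u hu => by
        simpa only [extChartAt_source] using hu
    have h2 : ContDiffOn ℝ ω (fun u => extChartAt I x (e u)) (e ⁻¹' (extChartAt I x).source) :=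
      contMDiffOn_iff_contDiffOn.1 h1
    have h3 : AnalyticAt ℝ (fun u => extChartAt I x (e u)) u :=
      ((h2 u hu).contDiffAt (hUo.mem_nhds hu)).analyticAt
    exact (((ContinuousLinearMap.proj i : (Fin n → ℝ) →L[ℝ] ℝ).comp
      (Lc : E →L[ℝ] (Fin n → ℝ))).analyticAt _).comp h3
  -- a compact set containing `T`, and the pieces `C x ⊆ e⁻¹(source x)`
  obtain ⟨R, hR⟩ := hTb.subset_closedBall 0
  have hB : IsCompact (Metric.closedBall (0 : Fin m → ℝ) R) := isCompact_closedBall 0 R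
  have hKdef : ∀ x : M, IsCompact {y : M | y ∈ (extChartAt I x).source ∧
      ∑ j, (Lc (extChartAt I x y) j - Lc (extChartAt I x x) j) ^ 2 ≤ ρ x ^ 2} :=
    fun x => (chart_bump_data I Lc x (hρ0 x) (hρsub x)).1
  have hD : ∀ x : M, ∃ D : Set (Fin m → ℝ),
      Metric.closedBall (0 : Fin m → ℝ) R ∩ e ⁻¹' {y : M | y ∈ (extChartAt I x).source ∧
        ∑ j, (Lc (extChartAt I x y) j - Lc (extChartAt I x x) j) ^ 2 ≤ ρ x ^ 2} ⊆ D ∧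
      D ⊆ e ⁻¹' (extChartAt I x).source ∧ IsCompact D ∧
      (univ : Set ℝ).Definable L D ∧
      ∀ f : (Fin m → ℝ) → ℝ, AnalyticOnNhd ℝ f (e ⁻¹' (extChartAt I x).source) →
        (univ : Set ℝ).Definable L
          {v : Fin (m + 1) → ℝ | Fin.init v ∈ D ∧ v (Fin.last m) = f (Fin.init v)} := by
    intro x
    refine hL.exists_boxes_definable_graphOn hAn
      ((isOpen_extChartAt_source x).preimage he.continuous)
      (hB.inter_right ((hKdef x).isClosed.preimage he.continuous)) ?_
    rintro u ⟨-, hu⟩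
    exact hu.1
  choose D hCD hDO _ hDdef hDgraph using hD
  -- the vector graphs of `ψ x ∘ e` over `D x`
  have hVG : ∀ x : ↥t, (univ : Set ℝ).Definable L
      {w : Fin m ⊕ Fin n → ℝ | (fun j => w (Sum.inl j)) ∈ D x ∧
        ∀ i, w (Sum.inr i) = Lc (extChartAt I (x : M) (e (fun j => w (Sum.inl j)))) i} :=
    fun x => IsRealFieldExpansion.definable_vectorGraphOn
      (h := fun u i => Lc (extChartAt I (x : M) (e u)) i) (hDdef x) fun i => hDgraph x _ (han x i)
  have hREL := definable_bumpChartRelation_of_isRealFieldExpansion hL (κ := ↥t) hT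
    (fun x : ↥t => hDdef x)
    (fun (x : ↥t) u i => Lc (extChartAt I (x : M) (e u)) i) hVG
    (fun x : ↥t => Lc (extChartAt I (x : M) x)) (fun x : ↥t => (ρ x ^ 2)⁻¹)
  -- the first-order description is correct on the closed ball
  have hrel : ∀ u ∈ Metric.closedBall (0 : Fin m → ℝ) R, ∀ z : ↥t × Option (Fin n) → ℝ,
      (∀ x : ↥t,
        ((u ∈ D x ∧ ∃ w : Fin n → ℝ,
            (u ∈ D x ∧ ∀ i, w i = Lc (extChartAt I (x : M) (e u)) i) ∧
            z (x, none) =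
              max 0 (min 1 (4 * (1 - (∑ i, (w i - Lc (extChartAt I (x : M) x) i) ^ 2) *
                (ρ x ^ 2)⁻¹) / 3)) ∧
            ∀ i, z (x, some i) = z (x, none) * w i) ∨
        (¬ u ∈ D x ∧ z (x, none) = 0 ∧ ∀ i, z (x, some i) = 0))) ↔ z = F₀ (e u) := by
    intro u hu z
    -- off `D x` the bump vanishes at `e u`
    have hoff : ∀ x : ↥t, u ∉ D x → b x (e u) = 0 := by
      intro x hx
      refine (hbp x).2.2.2.2 (e u) fun h => hx (hCD x ⟨hu, h⟩)
    constructor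
    · intro h
      funext k
      obtain ⟨x, o⟩ := k
      rcases h x with ⟨hxD, w, ⟨-, hw⟩, hz0, hzi⟩ | ⟨hxD, hz0, hzi⟩
      · have hsrc : e u ∈ (extChartAt I (x : M)).source := hDO x hxD
        have hw' : w = Lc (extChartAt I (x : M) (e u)) := funext hw
        have hb0 : b x (e u) = z (x, none) := by
          rw [hz0, hbdef]
          simp only [indicator_of_mem hsrc, hw']
        cases o with
        | none => simp [hF₀, hb0]
        | some i => simp [hF₀, hzi i, hb0, hw']
      · cases o with
        | none => simp [hF₀, hz0, hoff x hxD]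
        | some i => simp [hF₀, hzi i, hoff x hxD]
    · rintro rfl x
      by_cases hxD : u ∈ D x
      · have hsrc : e u ∈ (extChartAt I (x : M)).source := hDO x hxD
        refine Or.inl ⟨hxD, Lc (extChartAt I (x : M) (e u)), ⟨hxD, fun i => rfl⟩, ?_, fun i => ?_⟩
        · simp only [hF₀, Option.elim, hbdef, indicator_of_mem hsrc]
        · simp only [hF₀, Option.elim]
      · exact Or.inr ⟨hxD, by simp [hF₀, hoff x hxD], fun i => by simp [hF₀, hoff x hxD]⟩
  -- hence `F(e(T))` is the projection of the described set, re-indexed by `eqv`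
  have hTB : T ⊆ Metric.closedBall (0 : Fin m → ℝ) R := hR
  set S₀ : Set (↥t × Option (Fin n) → ℝ) := {z | ∃ u : Fin m → ℝ, u ∈ T ∧ ∀ x : ↥t,
        ((u ∈ D x ∧ ∃ w : Fin n → ℝ,
            (u ∈ D x ∧ ∀ i, w i = Lc (extChartAt I (x : M) (e u)) i) ∧
            z (x, none) =
              max 0 (min 1 (4 * (1 - (∑ i, (w i - Lc (extChartAt I (x : M) x) i) ^ 2) *
                (ρ x ^ 2)⁻¹) / 3)) ∧
            ∀ i, z (x, some i) = z (x, none) * w i) ∨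
        (¬ u ∈ D x ∧ z (x, none) = 0 ∧ ∀ i, z (x, some i) = 0))} with hS₀
  have hS₀def : (univ : Set ℝ).Definable L S₀ := by
    rw [hS₀]
    exact definable_setOf_exists_fin (P := fun (z : ↥t × Option (Fin n) → ℝ) (u : Fin m → ℝ) =>
      u ∈ T ∧ ∀ x : ↥t,
        ((u ∈ D x ∧ ∃ w : Fin n → ℝ,
            (u ∈ D x ∧ ∀ i, w i = Lc (extChartAt I (x : M) (e u)) i) ∧
            z (x, none) =
              max 0 (min 1 (4 * (1 - (∑ i, (w i - Lc (extChartAt I (x : M) x) i) ^ 2) *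
                (ρ x ^ 2)⁻¹) / 3)) ∧
            ∀ i, z (x, some i) = z (x, none) * w i) ∨
        (¬ u ∈ D x ∧ z (x, none) = 0 ∧ ∀ i, z (x, some i) = 0))) hREL
  have himage : (F ∘ e) '' T = (fun g : Fin N → ℝ => g ∘ eqv) ⁻¹' S₀ := by
    ext z'
    rw [mem_preimage, hS₀, mem_setOf_eq, mem_image]
    constructor
    · rintro ⟨u, huT, rfl⟩
      refine ⟨u, huT, (hrel u (hTB huT) ((F ∘ e) u ∘ ⇑eqv)).2 ?_⟩
      funext k
      simp only [Function.comp_apply, hF, Equiv.symm_apply_apply]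
    · rintro ⟨u, huT, h⟩
      refine ⟨u, huT, ?_⟩
      have hz : (z' ∘ ⇑eqv) = F₀ (e u) := (hrel u (hTB huT) (z' ∘ ⇑eqv)).1 h
      funext l
      have := congr_fun hz (eqv.symm l)
      simpa [hF] using this.symm
  rw [himage]
  exact hS₀def.preimage_comp _

/-- **Analytically parametrised closed subsets of a compact analytic manifold are homeomorphic to
compact `L`-definable subsets of `ℝᴺ`, for any expansion `L` of the real field defining the
restricted analytic functions.** If `C ⊆ M` is closed and `C = ex(T)` for a real-analytic `ex : E' → M`
(`E'` finite-dimensional) and a BOUNDED SUBANALYTIC `T ⊆ E'`, then `C` is homeomorphic to a compact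
`L`-definable `X ⊆ ℝᴺ` (namely `X = F(C) = (F ∘ ex)(T)` for the embedding `F` of
`exists_embedding_definable_image_of_restrictedAnalytic`, `T` being `L`-definable by
`IsSubanalytic.definable_image_of_restrictedAnalytic`). The cut locus `C(p) = exp_p(TCL(p))` is the
case in point. [cite: Pila2022, 8.21] -/
theorem exists_definable_homeomorph_of_eq_image_of_restrictedAnalytic (hL : IsRealFieldExpansion L)
    (hAn : ∀ (n : ℕ) (f : RestrictedAnalytic n), (univ : Set ℝ).DefinableFun L f.restrict)
    [FiniteDimensional ℝ E] [IsManifold I ω M]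
    {E' : Type*} [NormedAddCommGroup E'] [NormedSpace ℝ E'] [FiniteDimensional ℝ E']
    {ex : E' → M} (hex : ContMDiff 𝓘(ℝ, E') I ω ex) {T : Set E'} (hT : IsSubanalytic T)
    (hTb : Bornology.IsBounded T) {C : Set M} (hC : IsClosed C) (hCT : C = ex '' T) :
    ∃ (N : ℕ) (X : Set (Fin N → ℝ)), IsCompact X ∧
      (univ : Set ℝ).Definable L X ∧ Nonempty (C ≃ₜ X) := by
  -- coordinates on `E'`
  set m : ℕ := Module.finrank ℝ E' with hm
  have hdim : Module.finrank ℝ E' = Module.finrank ℝ (Fin m → ℝ) := by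
    rw [Module.finrank_fin_fun]
  set L' : E' ≃L[ℝ] (Fin m → ℝ) := ContinuousLinearEquiv.ofFinrankEq hdim with hL'
  obtain ⟨N, F, hFc, hFinj, hFdef⟩ :=
    exists_embedding_definable_image_of_restrictedAnalytic (M := M) I hL hAn
  set e : (Fin m → ℝ) → M := fun u => ex (L'.symm u) with he
  have hea : ContMDiff 𝓘(ℝ, Fin m → ℝ) I ω e :=
    hex.comp (contMDiff_iff_contDiff.2 (L'.symm : (Fin m → ℝ) →L[ℝ] E').contDiff)
  have hTdef : (univ : Set ℝ).Definable L (L' '' T) :=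
    hT.definable_image_of_restrictedAnalytic hL hAn hTb L'
  have hTb' : Bornology.IsBounded (L' '' T) := L'.lipschitz.isBounded_image hTb
  have hX : (F ∘ e) '' (L' '' T) = F '' C := by
    rw [hCT, image_image, image_image]
    refine image_congr fun v _ => ?_
    simp [he]
  refine ⟨N, F '' C, (hC.isCompact.image hFc), hX ▸ hFdef m e hea _ hTdef hTb', ⟨?_⟩⟩
  -- `C ≃ₜ F(C)` through the closed embedding `F`
  have hemb : IsEmbedding (F ∘ ((↑) : C → M)) :=
    (hFc.isClosedEmbedding hFinj).isEmbedding.comp IsEmbedding.subtypeVal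
  exact hemb.toHomeomorph.trans (Homeomorph.setCongr (image_eq_range F C).symm)

end Embedding

end Literature.Geometry.Manifold
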